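import Literature.MathematicalPhysics.QuantumFieldTheory.Balaban1983to89.BlockAveragingPlaquetteBoundLocal
import Literature.MathematicalPhysics.QuantumFieldTheory.Balaban1983to89.BlockAveragingEMLProp2
import Literature.MathematicalPhysics.QuantumFieldTheory.Balaban1983to89.B15DeterminingSets
import HarnessLib

/-!
# `Balaban1983to89.BlockAveragingTowerStraightTransportLocal` — THE `k`-FOLD (0.4) AVERAGE `(M^k U₀)(c)` VERSUS THE FINE STRAIGHT
# TRANSPORTER `U₀([embIter k c₋ → L^k steps e_c])`, IN `dist1` CURRENCY, FOR ANY `LoopAverage`, UNDER A HYPOTHESIS ON THE LINE ONLY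

Cell `pub-ymgap` (Track A DAG, node N12 [Balaban1989LargeFieldI] = [B15]), width seat `dag-n12-w2` (g4); count-neutral Literature helper
(`--supports` the K1 crux of `route-QuantumFields-BalabanUVNodes`).  HONEST FRAMING: lattice bookkeeping on the tree's own objects
(`BlockAveraging.avgFun ∕ corr`, `Averaging.iter`, `T4Continuum.holAt ∕ walk`, `B15DeterminingSets.embIter`); nothing of Bałaban's is asserted;
no node is discharged by this file; one finite `𝕋⁴` programme at fixed `ε`; nothing here bears on the continuum ∕ OS ∕ mass-gap statement.

WHY THIS FILE EXISTS.  T. Bałaban, *Renormalization group approach to lattice gauge field theories. I*, Commun. Math. Phys. **109** (1987) 249–301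
[Balaban1987RG1], (0.4) p. 253 (the symmetric block averaging `Ū(c) = exp[…]·U(c)`, tree `BlockAveraging.avgFun ℰ U c = corr ℰ U c * axialAvg U c`)
and (0.11) p. 253 (the `k`-fold iterate `Ū^k = M^k(U)`, tree `Averaging.iter`).  Unwinding the recursion, the level-`k` bond variable `(M^k U₀)(c)` is
the holonomy of `U₀` along the fine straight segment of `L^k` bonds from the `k`-fold centre `embIter k c₋` in direction `e_c`, corrected at every
level `j < k` by the correction factors `corr ℰ (M^j U₀) c′` of the `(L^k − 1)∕(L − 1)` coarse bonds `c′` LYING ON THAT SEGMENT.  Hence, if those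
correction factors are within `κ j` of `1`, then `dist1 ((M^k U₀)(c) · U₀([embIter k c₋ → L^k e_c])⁻¹) ≤ θ k` for any `θ` with `0 ≤ θ 0` and
`κ j + L·θ j ≤ θ (j+1)` (§3, ★★ `dist1_iter_blockAvg_mul_inv_straight_le_local`).  This is the LOCAL, `dist1`-valued, `LoopAverage`-generic
edition of the Summits-side `Summit.QuantumFields.YangMills.Theorems.Prop7TowerStraightTransport.norm_iter_sub_straightIter_le` (cell `ym3-torus`,
matrix-norm currency, hypothesis on ALL level-`j` loop variables; not importable from `Literature/`).  The local form is what the N12 lane's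
«interior letter» road (dag-n12-w6 `Q2-DESIGN.md` §4, bricks C2–C3: a CORRIDOR input bond of the tower-axial gauge is a closed word at one tower root
times the straight transporter between the two roots) consumes: the minimiser's plaquettes are small only near `Ω_j`, so only the bonds on the
segment may be assumed to have small loop variables.

WHAT IS PROVED (no `def`, no `sorry`; `G` any `GaugeGroup`, `ℰ` any `LoopAverage G` unless said):
* §1 `dist1` telescoping from bi-invariance alone: `dist1_mul_mul_inv_mul_le`, ★ `dist1_holAt_straight_mul_inv_le` (two fields, one straight walk),
  `dist1_le_dist1_mul_inv_add` (the one-factor insertion `|κXY⁻¹ − 1| ≤ |κ − 1| + |XY⁻¹ − 1|` is the tree's `B15SmallField185.dist1_mul_mul_inv_le`, inlined);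
* §2 straight walks and the iterated centre embedding: `walkEnd_replicate_true_eq_iterate`, `holAt_walk_replicate_true_succ`, `holAt_walk_replicate_true_add`,
  `emb_iterate_shift`, ★ `embIter_iterate_shift` (`embIter k (y + t e_μ) = embIter k y + t·L^k e_μ`), ★ `holAt_straight_of_segments` (a coarse straight walk
  of a field whose bond variables are fine straight transporters of `b` steps is the fine straight walk of `a·b` steps — the Literature twin, specialised to
  straight words, of `Summit.….Prop7FlatHolonomy.holAt_walk_of_straight`);
* §3 ★★ `dist1_iter_blockAvg_mul_inv_straight_le_local` (title), the swapped reading `dist1_straight_mul_inv_iter_le_local`, and the corollary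
  ★ `dist1_straight_le_local` (`dist1 (U₀([embIter k c₋ → L^k e_c])) ≤ θ k + dist1 ((M^k U₀)(c))`);
* §4 `SU(N)`, `ℰ = expMeanLogSU`: the letter `κ` discharged (a) from the sizes of the loop variables of the line bonds
  (`BlockAveragingEMLProp2.dist1_corr_le_two_mul`: `κ j = 2·a j`, `a j ≤ 1∕6`, `a j < δ_N`) — ★ `dist1_iter_mul_inv_straight_le_of_loopHol_local` — and
  (b) from the smallness of the level-`j` plaquettes based in the three blocks around each line bond (`BlockAveragingPlaquetteBoundLocal.dist1_corr_le_local`: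
  `κ j = 6·(((d+2)L)²∕4)·a j`) — ★★ `dist1_iter_mul_inv_straight_le_of_plaqSmall_local`, standing range `k ≤ m + K`.
WHAT THIS IS NOT: no statement about which plaquettes of `M^j U₀` are small (that is [Balaban1985Averaging] Prop. 1 in local form, tree
`BlockAveragingPlaquetteBoundLocal.plaqSmallOn_avgFun_of_near`, iterated by the caller on its own geometry); no closed-word ∕ Stokes step (tree
`LatticeWordStokesLocal`); constants crude.

References: T. Bałaban, CMP 109 (1987) 249–301 [Balaban1987RG1] ((0.1) p.251, (0.4), (0.11) p.253); CMP 98 (1985) 17–51 [Balaban1985Averaging] ((26)–(27) p.22);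
CMP 95 (1984) 17–40 [Balaban1984PropagatorsI] ((1.7) p.18: the straight-line transporter).
-/

noncomputable section

open scoped BigOperators

namespace Literature.MathematicalPhysics.QuantumFieldTheory.Balaban1983to89.BlockAveragingTowerStraightTransportLocal

open T4Continuum BlockAveraging AveragingRT B15DeterminingSets

/-! ## §1 `dist1` telescoping from bi-invariance -/

section Telescoping

variable {G : Type*} [GaugeGroup G]

/-- `dist1 (a·b·(a′·b′)⁻¹) ≤ dist1 (a·a′⁻¹) + dist1 (b·b′⁻¹)`: write `a b (a′b′)⁻¹ = (a a′⁻¹)·(a′ (b b′⁻¹) a′⁻¹)` and use the triangle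
inequality and conjugation invariance of `dist1` (the unitary invariance (19)–(20) of the distance).  (Prints like the Summits-side
`Summit.QuantumFields.Balaban3D.Proofs.FibreClashWitness.dist1_mul_mul_inv_le` — another summit tree, not importable here.) [cite: Balaban1985Averaging, (19)-(20) p.21] -/
theorem dist1_mul_mul_inv_mul_le (a b a' b' : G) :
    dist1 (a * b * (a' * b')⁻¹) ≤ dist1 (a * a'⁻¹) + dist1 (b * b'⁻¹) := by
  have e : a * b * (a' * b')⁻¹ = (a * a'⁻¹) * (a' * (b * b'⁻¹) * a'⁻¹) := by group
  rw [e]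
  refine (GaugeGroup.dist1_mul_le _ _).trans ?_
  rw [GaugeGroup.dist1_conj]

/-- `dist1 b ≤ dist1 (a·b⁻¹) + dist1 a` (`b = (a b⁻¹)⁻¹ · a`; invariance (19)–(20) of the distance).  (Prints like the Summits-side
`Summit.QuantumFields.Balaban3D.Proofs.FibreClashWitness.dist1_le_dist1_mul_inv_add'` — not importable here.) [cite: Balaban1985Averaging, (19)-(20) p.21] -/
theorem dist1_le_dist1_mul_inv_add (a b : G) : dist1 b ≤ dist1 (a * b⁻¹) + dist1 a := by
  have e : b = (a * b⁻¹)⁻¹ * a := by group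
  calc dist1 b = dist1 ((a * b⁻¹)⁻¹ * a) := by rw [← e]
    _ ≤ dist1 (a * b⁻¹)⁻¹ + dist1 a := GaugeGroup.dist1_mul_le _ _
    _ = dist1 (a * b⁻¹) + dist1 a := by rw [GaugeGroup.dist1_inv]

variable {P : Params} {j : ℕ}

/-- ★ **STRAIGHT-WALK TELESCOPING IN `dist1`**: for two level-`j` configurations `A`, `B` and the straight walk of `m` steps `+e_μ` from `x`,
`dist1 (A([x → m e_μ]) · B([x → m e_μ])⁻¹) ≤ Σ_{t<m} dist1 (A(x + t e_μ, μ) · B(x + t e_μ, μ)⁻¹)` — the straight-line transporter (1.7) of two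
configurations compared bond by bond through the invariance (19)–(20) of the distance. [cite: Balaban1984PropagatorsI, (1.7) p.18; Balaban1985Averaging, (19)-(20) p.21] -/
theorem dist1_holAt_straight_mul_inv_le (A B : GaugeField P j G) (μ : Fin P.d) :
    ∀ (m : ℕ) (x : Site P j),
      dist1 (holAt A (walk x (List.replicate m (μ, true))) * (holAt B (walk x (List.replicate m (μ, true))))⁻¹)
        ≤ ∑ t ∈ Finset.range m,
            dist1 (A ⟨(fun z : Site P j => z.shift μ)^[t] x, μ⟩ * (B ⟨(fun z : Site P j => z.shift μ)^[t] x, μ⟩)⁻¹)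
  | 0, x => by simp [walk, holAt_nil, GaugeGroup.dist1_one]
  | m + 1, x => by
    rw [List.replicate_succ, walk, holAt_cons, holAt_cons, Finset.sum_range_succ']
    simp only [if_true, Function.iterate_succ_apply, Function.iterate_zero_apply]
    have ih := dist1_holAt_straight_mul_inv_le A B μ m (x.shift μ)
    calc dist1 (A ⟨x, μ⟩ * holAt A (walk (x.shift μ) (List.replicate m (μ, true))) *
            (B ⟨x, μ⟩ * holAt B (walk (x.shift μ) (List.replicate m (μ, true))))⁻¹)
        ≤ dist1 (A ⟨x, μ⟩ * (B ⟨x, μ⟩)⁻¹) +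
            dist1 (holAt A (walk (x.shift μ) (List.replicate m (μ, true))) *
              (holAt B (walk (x.shift μ) (List.replicate m (μ, true))))⁻¹) := dist1_mul_mul_inv_mul_le _ _ _ _
      _ ≤ _ := by rw [add_comm]; exact add_le_add ih le_rfl

end Telescoping

/-! ## §2 Straight walks, the centre embedding and its iterate -/

section Straight

variable {P : Params} {j : ℕ}

/-- The straight walk of `m` steps `+e_μ` from `x` ends at `x + m e_μ` (the contour of the straight-line transporter (1.7); prints like the
Summits-side `…Prop7LineIterRepr.walkEnd_replicate_true_eq_iterate`, not importable here). [cite: Balaban1984PropagatorsI, (1.7) p.18] -/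
theorem walkEnd_replicate_true_eq_iterate (μ : Fin P.d) : ∀ (m : ℕ) (x : Site P j),
    walkEnd x (List.replicate m (μ, true)) = (fun z : Site P j => z.shift μ)^[m] x
  | 0, x => rfl
  | m + 1, x => by
    rw [List.replicate_succ, walkEnd, walkEnd_replicate_true_eq_iterate μ m (x.shift μ), Function.iterate_succ_apply]

/-- `emb (y + t e_μ) = emb y + t·L e_μ`: the centre embedding intertwines the unit shift of `T^{(j+1)}` with the `L`-fold shift of `T^{(j)}`
(`BlockAveraging.walkEnd_replicate_L` iterated). [cite: Balaban1987RG1, (0.1) p.251] -/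
theorem emb_iterate_shift (μ : Fin P.d) : ∀ (t : ℕ) (y : Site P (j + 1)),
    emb ((fun z : Site P (j + 1) => z.shift μ)^[t] y) = (fun z : Site P j => z.shift μ)^[t * P.L] (emb y)
  | 0, y => by simp
  | t + 1, y => by
    rw [Function.iterate_succ_apply, emb_iterate_shift μ t (y.shift μ), ← walkEnd_replicate_L, walkEnd_replicate_true_eq_iterate,
      ← Function.iterate_add_apply, Nat.succ_mul]

/-- ★ `embIter k (y + t e_μ) = embIter k y + t·L^k e_μ` on `T^{(0)}`. [cite: Balaban1987RG1, (0.1) p.251] -/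
theorem embIter_iterate_shift (μ : Fin P.d) : ∀ (k : ℕ) (t : ℕ) (y : Site P k),
    embIter k ((fun z : Site P k => z.shift μ)^[t] y) = (fun z : Site P 0 => z.shift μ)^[t * P.L ^ k] (embIter k y)
  | 0, t, y => by simp [embIter]
  | k + 1, t, y => by
    show embIter k (emb ((fun z : Site P (k + 1) => z.shift μ)^[t] y)) = _
    have e : t * P.L * P.L ^ k = t * P.L ^ (k + 1) := by ring
    rw [emb_iterate_shift, embIter_iterate_shift μ k (t * P.L) (emb y), e]
    rfl

/-- `embIter (k+1) y = embIter k (emb y)` (definitional; prints like the Summits-side `…Prop7TrueLinPureGaugeIter.embIter_succ`, not importable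
here). [cite: Balaban1987RG1, (0.1) p.251] -/
theorem embIter_succ (k : ℕ) (y : Site P (k + 1)) : embIter (k + 1) y = embIter k (emb y) := rfl

variable {G : Type*} [GaugeGroup G]

/-- `U([x → (m+1) e_μ]) = U(x, μ) · U([x + e_μ → m e_μ])` (the straight-line transporter (1.7), first bond split off). [cite: Balaban1984PropagatorsI, (1.7) p.18] -/
theorem holAt_walk_replicate_true_succ (U : GaugeField P j G) (x : Site P j) (μ : Fin P.d) (m : ℕ) :
    holAt U (walk x (List.replicate (m + 1) (μ, true))) = U ⟨x, μ⟩ * holAt U (walk (x.shift μ) (List.replicate m (μ, true))) := by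
  rw [List.replicate_succ, walk, holAt_cons]
  simp only [if_true]

/-- `U([x → 1 e_μ]) = U(x, μ)` (the straight-line transporter (1.7) of one bond). [cite: Balaban1984PropagatorsI, (1.7) p.18] -/
theorem holAt_walk_replicate_true_one (U : GaugeField P j G) (x : Site P j) (μ : Fin P.d) :
    holAt U (walk x (List.replicate 1 (μ, true))) = U ⟨x, μ⟩ := by
  rw [holAt_walk_replicate_true_succ]
  simp [walk, holAt_nil]

/-- `U([x → (a+b) e_μ]) = U([x → a e_μ]) · U([x + a e_μ → b e_μ])` (multiplicativity of the straight-line transporter (1.7)). [cite: Balaban1984PropagatorsI, (1.7) p.18] -/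
theorem holAt_walk_replicate_true_add (U : GaugeField P j G) (x : Site P j) (μ : Fin P.d) (a b : ℕ) :
    holAt U (walk x (List.replicate (a + b) (μ, true))) =
      holAt U (walk x (List.replicate a (μ, true))) *
        holAt U (walk ((fun z : Site P j => z.shift μ)^[a] x) (List.replicate b (μ, true))) := by
  rw [List.replicate_add, walk_append, holAt_append, walkEnd_replicate_true_eq_iterate]

/-- ★ **A COARSE STRAIGHT WALK OF FINE STRAIGHT TRANSPORTERS IS A FINE STRAIGHT WALK.**  Let `f : T^{(j′)} → T^{(j)}` intertwine the unit
shift in direction `μ` with the `b`-fold shift (`f (z + e_μ) = f z + b e_μ`), and let the level-`j′` configuration `W` have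
`W(z, μ) = U([f z → b e_μ])` along the walk.  Then `W([y → a e_μ]) = U([f y → a·b e_μ])`.  (The Literature twin, specialised to straight words, of
the Summits-side `Prop7FlatHolonomy.holAt_walk_of_straight`.) [cite: Balaban1984PropagatorsI, (1.7) p.18] -/
theorem holAt_straight_of_segments {j' : ℕ} (U : GaugeField P j G) (W : GaugeField P j' G) (μ : Fin P.d) (b : ℕ)
    (f : Site P j' → Site P j) (hf : ∀ z, f (z.shift μ) = (fun z : Site P j => z.shift μ)^[b] (f z))
    (hW : ∀ z, W ⟨z, μ⟩ = holAt U (walk (f z) (List.replicate b (μ, true)))) :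
    ∀ (a : ℕ) (y : Site P j'),
      holAt W (walk y (List.replicate a (μ, true))) = holAt U (walk (f y) (List.replicate (a * b) (μ, true)))
  | 0, y => by simp [walk, holAt_nil]
  | a + 1, y => by
    rw [holAt_walk_replicate_true_succ, hW, holAt_straight_of_segments U W μ b f hf hW a (y.shift μ), hf, Nat.succ_mul, add_comm,
      holAt_walk_replicate_true_add]

/-- The `κ`-free recursion of the fine straight transporters of the tower: `U₀([embIter (k+1) c₋ → L^{k+1} e_c])` is the straight
walk of `L` steps, from `emb c₋`, of the level-`k` field `c′ ↦ U₀([embIter k c′₋ → L^k e_{c′}])`. [cite: Balaban1987RG1, (0.4) and (0.11) p.253] -/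
theorem holAt_straight_embIter_succ (U₀ : GaugeField P 0 G) (k : ℕ) (c : PBond P (k + 1)) :
    holAt U₀ (walk (embIter (k + 1) c.src) (List.replicate (P.L ^ (k + 1)) (c.dir, true))) =
      holAt (fun c' : PBond P k => holAt U₀ (walk (embIter k c'.src) (List.replicate (P.L ^ k) (c'.dir, true))))
        (walk (emb c.src) (List.replicate P.L (c.dir, true))) := by
  rw [holAt_straight_of_segments U₀ _ c.dir (P.L ^ k) (embIter k) (fun z => ?_) (fun z => rfl) P.L (emb c.src), pow_succ']
  · rfl
  · have h := embIter_iterate_shift (P := P) c.dir k 1 z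
    simp only [Function.iterate_one, one_mul] at h
    exact h

end Straight

/-! ## §3 ★★ The `k`-fold average versus the fine straight transporter, hypothesis on the line only -/

section Main

variable {P : Params} {G : Type*} [GaugeGroup G]

/-- ★★ **`(M^k U₀)(c)` IS THE FINE STRAIGHT TRANSPORTER UP TO `θ k`, UNDER A HYPOTHESIS ON THE LINE ONLY.**  `ℰ` any `LoopAverage`,
`M^j U₀ = Averaging.iter (fun i => blockAvg ℰ) j U₀`.  Fix a level-`k` bond `c`; its FINE SEGMENT is `{embIter k c₋ + s e_c : s < L^k} ⊂ T^{(0)}`.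
Hypothesis (the letter `hκ`): for every `j < k` and every level-`(j+1)` bond `c′` in direction `e_c` whose `(j+1)`-fold centre `embIter (j+1) c′₋`
lies on that segment, the correction factor satisfies `dist1 (corr ℰ (M^j U₀) c′) ≤ κ j`; and `0 ≤ θ 0`, `κ j + L·θ j ≤ θ (j+1)`.  Conclusion:
`dist1 ((M^k U₀)(c) · U₀([embIter k c₋ → L^k e_c])⁻¹) ≤ θ k`.  Proof: induction on `k` along `(M^{k+1}U₀)(c) = corr·(M^k U₀)([emb c₋ → L e_c])`
(definition of (0.4), `axialAvg_eq_holAt_walk`), the `κ`-free recursion `holAt_straight_embIter_succ`, and §1. [cite: Balaban1987RG1, (0.4) and (0.11) p.253] -/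
theorem dist1_iter_blockAvg_mul_inv_straight_le_local (ℰ : LoopAverage G) (U₀ : GaugeField P 0 G) (κ θ : ℕ → ℝ)
    (hθ0 : 0 ≤ θ 0) (hθ : ∀ j, κ j + P.L * θ j ≤ θ (j + 1)) :
    ∀ (k : ℕ) (c : PBond P k),
      (∀ j < k, ∀ c' : PBond P (j + 1), c'.dir = c.dir →
          (∃ s < P.L ^ k, embIter (j + 1) c'.src = (fun z : Site P 0 => z.shift c.dir)^[s] (embIter k c.src)) →
          dist1 (corr ℰ (Averaging.iter (fun i => blockAvg (P := P) (j := i) ℰ) j U₀) c') ≤ κ j) →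
      dist1 (Averaging.iter (fun i => blockAvg (P := P) (j := i) ℰ) k U₀ c *
          (holAt U₀ (walk (embIter k c.src) (List.replicate (P.L ^ k) (c.dir, true))))⁻¹) ≤ θ k := by
  intro k
  induction k with
  | zero =>
    intro c _
    have h0 : Averaging.iter (fun i => blockAvg (P := P) (j := i) ℰ) 0 U₀ = U₀ := rfl
    rw [h0, pow_zero, show embIter 0 c.src = c.src from rfl, holAt_walk_replicate_true_one, mul_inv_cancel, GaugeGroup.dist1_one]
    exact hθ0
  | succ k ih =>
    intro c hκ
    set V := Averaging.iter (fun i => blockAvg (P := P) (j := i) ℰ) k U₀ with hV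
    -- the tower's recursion (0.4)/(0.11) and the `κ`-free recursion of the straight transporters
    have hiter : Averaging.iter (fun i => blockAvg (P := P) (j := i) ℰ) (k + 1) U₀ c = corr ℰ V c * axialAvg V c := rfl
    rw [hiter, axialAvg_eq_holAt_walk, holAt_straight_embIter_succ]
    set S : GaugeField P k G := fun c' : PBond P k => holAt U₀ (walk (embIter k c'.src) (List.replicate (P.L ^ k) (c'.dir, true)))
      with hS
    -- the correction factor at `c` itself (`j = k`, `s = 0`)
    have hκc : dist1 (corr ℰ V c) ≤ κ k :=
      hκ k (Nat.lt_succ_self k) c rfl ⟨0, pow_pos P.L_pos _, rfl⟩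
    -- the `L` sub-segments, each by the induction hypothesis
    have hseg : ∀ t ∈ Finset.range P.L,
        dist1 (V ⟨(fun z : Site P k => z.shift c.dir)^[t] (emb c.src), c.dir⟩ *
            (S ⟨(fun z : Site P k => z.shift c.dir)^[t] (emb c.src), c.dir⟩)⁻¹) ≤ θ k := by
      intro t ht
      have htL : t < P.L := Finset.mem_range.mp ht
      refine ih ⟨(fun z : Site P k => z.shift c.dir)^[t] (emb c.src), c.dir⟩ fun j hj c' hdir hs => ?_
      refine hκ j (Nat.lt_succ_of_lt hj) c' hdir ?_
      obtain ⟨s, hsL, hs⟩ := hs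
      refine ⟨s + t * P.L ^ k, ?_, ?_⟩
      · calc s + t * P.L ^ k < P.L ^ k + t * P.L ^ k := Nat.add_lt_add_right hsL _
          _ = (t + 1) * P.L ^ k := by ring
          _ ≤ P.L * P.L ^ k := Nat.mul_le_mul_right _ htL
          _ = P.L ^ (k + 1) := by rw [pow_succ']
      · rw [hs]
        show (fun z : Site P 0 => z.shift c.dir)^[s] (embIter k ((fun z : Site P k => z.shift c.dir)^[t] (emb c.src))) = _
        rw [embIter_iterate_shift, ← Function.iterate_add_apply]
        rfl
    calc dist1 (corr ℰ V c * holAt V (walk (emb c.src) (List.replicate P.L (c.dir, true))) *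
            (holAt S (walk (emb c.src) (List.replicate P.L (c.dir, true))))⁻¹)
        ≤ dist1 (corr ℰ V c) + dist1 (holAt V (walk (emb c.src) (List.replicate P.L (c.dir, true))) *
            (holAt S (walk (emb c.src) (List.replicate P.L (c.dir, true))))⁻¹) := by
          -- `|κ·X·Y⁻¹ − 1| ≤ |κ − 1| + |X·Y⁻¹ − 1|` (the tree's `B15SmallField185.dist1_mul_mul_inv_le`, (1.32) p.184; inlined to keep the imports light)
          rw [mul_assoc]; exact GaugeGroup.dist1_mul_le _ _
      _ ≤ κ k + ∑ t ∈ Finset.range P.L,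
            dist1 (V ⟨(fun z : Site P k => z.shift c.dir)^[t] (emb c.src), c.dir⟩ *
              (S ⟨(fun z : Site P k => z.shift c.dir)^[t] (emb c.src), c.dir⟩)⁻¹) :=
          add_le_add hκc (dist1_holAt_straight_mul_inv_le V S c.dir P.L (emb c.src))
      _ ≤ κ k + ∑ _t ∈ Finset.range P.L, θ k := add_le_add le_rfl (Finset.sum_le_sum hseg)
      _ = κ k + P.L * θ k := by rw [Finset.sum_const, Finset.card_range, nsmul_eq_mul]
      _ ≤ θ (k + 1) := hθ k

/-- ★ **THE FINE STRAIGHT TRANSPORTER BETWEEN THE TWO `k`-FOLD CENTRES IS WITHIN `θ k + dist1 ((M^k U₀)(c))` OF `1`** (same hypotheses):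
the reading the corridor-bond estimate consumes — on a minimiser's fibre `(M^k U₀)(c)` is the prescribed datum at a constrained `c`.
[cite: Balaban1987RG1, (0.4) and (0.11) p.253] -/
theorem dist1_straight_le_local (ℰ : LoopAverage G) (U₀ : GaugeField P 0 G) (κ θ : ℕ → ℝ)
    (hθ0 : 0 ≤ θ 0) (hθ : ∀ j, κ j + P.L * θ j ≤ θ (j + 1)) (k : ℕ) (c : PBond P k)
    (hκ : ∀ j < k, ∀ c' : PBond P (j + 1), c'.dir = c.dir →
        (∃ s < P.L ^ k, embIter (j + 1) c'.src = (fun z : Site P 0 => z.shift c.dir)^[s] (embIter k c.src)) →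
        dist1 (corr ℰ (Averaging.iter (fun i => blockAvg (P := P) (j := i) ℰ) j U₀) c') ≤ κ j) :
    dist1 (holAt U₀ (walk (embIter k c.src) (List.replicate (P.L ^ k) (c.dir, true))))
      ≤ θ k + dist1 (Averaging.iter (fun i => blockAvg (P := P) (j := i) ℰ) k U₀ c) :=
  (dist1_le_dist1_mul_inv_add _ _).trans
    (add_le_add (dist1_iter_blockAvg_mul_inv_straight_le_local ℰ U₀ κ θ hθ0 hθ k c hκ) le_rfl)

/-- The same bound read with the factors swapped: `dist1 (U₀([embIter k c₋ → L^k e_c]) · ((M^k U₀)(c))⁻¹) ≤ θ k` (`|X Y⁻¹ − 1| = |Y X⁻¹ − 1|`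
by the invariance (19)–(20) of the distance) — the reading a forest-gauge consumer uses when the straight segment is its transporter `Ω`.
[cite: Balaban1987RG1, (0.4) and (0.11) p.253; Balaban1985Averaging, (19)-(20) p.21] -/
theorem dist1_straight_mul_inv_iter_le_local (ℰ : LoopAverage G) (U₀ : GaugeField P 0 G) (κ θ : ℕ → ℝ)
    (hθ0 : 0 ≤ θ 0) (hθ : ∀ j, κ j + P.L * θ j ≤ θ (j + 1)) (k : ℕ) (c : PBond P k)
    (hκ : ∀ j < k, ∀ c' : PBond P (j + 1), c'.dir = c.dir →
        (∃ s < P.L ^ k, embIter (j + 1) c'.src = (fun z : Site P 0 => z.shift c.dir)^[s] (embIter k c.src)) →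
        dist1 (corr ℰ (Averaging.iter (fun i => blockAvg (P := P) (j := i) ℰ) j U₀) c') ≤ κ j) :
    dist1 (holAt U₀ (walk (embIter k c.src) (List.replicate (P.L ^ k) (c.dir, true))) *
        (Averaging.iter (fun i => blockAvg (P := P) (j := i) ℰ) k U₀ c)⁻¹) ≤ θ k := by
  rw [← GaugeGroup.dist1_inv, mul_inv_rev, inv_inv]
  exact dist1_iter_blockAvg_mul_inv_straight_le_local ℰ U₀ κ θ hθ0 hθ k c hκ

/-- The segment hypothesis in `walkEnd` form implies the `iterate` form used above (`walkEnd_replicate_true_eq_iterate`) — a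
convenience for callers who locate coarse bonds by straight walks (`T^{(j)} ⊂ T^{(0)}` by the centres, (0.1)). [cite: Balaban1987RG1, (0.1) p.251] -/
theorem segment_iterate_of_walkEnd {k j : ℕ} (c : PBond P k) (c' : PBond P (j + 1))
    (h : ∃ s < P.L ^ k, embIter (j + 1) c'.src = walkEnd (embIter k c.src) (List.replicate s (c.dir, true))) :
    ∃ s < P.L ^ k, embIter (j + 1) c'.src = (fun z : Site P 0 => z.shift c.dir)^[s] (embIter k c.src) := by
  obtain ⟨s, hs, h⟩ := h
  exact ⟨s, hs, by rw [h, walkEnd_replicate_true_eq_iterate]⟩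

end Main

/-! ## §4 `SU(N)`, `ℰ = expMeanLogSU`: the letter `κ` from loop variables ∕ from plaquettes on the line -/

section SUN

open ExpMeanLog

variable {n : Type*} [Fintype n] [DecidableEq n] [Nonempty n] {P : Params}

/-- ★ **LOOP-VARIABLE EDITION** (`SU(N)`, the printed `exp[mean log]`): if for every `j < k` the (0.4) loop variables of `M^j U₀` at every
level-`(j+1)` bond of the segment are within `a j ≤ 1∕6`, `a j < δ_N`, of `1`, then
`dist1 ((M^k U₀)(c) · U₀([embIter k c₋ → L^k e_c])⁻¹) ≤ θ k` for any `θ` with `0 ≤ θ 0`, `2·a j + L·θ j ≤ θ (j+1)` — the local twin of the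
Summits-side `norm_iter_sub_straightIter_le` (`BlockAveragingEMLProp2.dist1_corr_le_two_mul`). [cite: Balaban1987RG1, (0.4) and (0.11) p.253] -/
theorem dist1_iter_mul_inv_straight_le_of_loopHol_local (U₀ : GaugeField P 0 (Matrix.specialUnitaryGroup n ℂ)) (a θ : ℕ → ℝ)
    (hθ0 : 0 ≤ θ 0) (hθ : ∀ j, 2 * a j + P.L * θ j ≤ θ (j + 1)) (k : ℕ) (c : PBond P k)
    (ha6 : ∀ j < k, a j ≤ 1 / 6) (haN : ∀ j < k, a j < deltaSU n)
    (ha : ∀ j < k, ∀ c' : PBond P (j + 1), c'.dir = c.dir →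
        (∃ s < P.L ^ k, embIter (j + 1) c'.src = (fun z : Site P 0 => z.shift c.dir)^[s] (embIter k c.src)) →
        ∀ i : Idx P, dist1 (loopHol (Averaging.iter (fun i => blockAvg (P := P) (j := i) (expMeanLogSU (n := n))) j U₀) c' i) ≤ a j) :
    dist1 (Averaging.iter (fun i => blockAvg (P := P) (j := i) (expMeanLogSU (n := n))) k U₀ c *
        (holAt U₀ (walk (embIter k c.src) (List.replicate (P.L ^ k) (c.dir, true))))⁻¹) ≤ θ k :=
  dist1_iter_blockAvg_mul_inv_straight_le_local (expMeanLogSU (n := n)) U₀ (fun j => 2 * a j) θ hθ0 hθ k c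
    fun j hj c' hdir hs => BlockAveragingEMLProp2.dist1_corr_le_two_mul _ c' (ha j hj c' hdir hs) (haN j hj) (ha6 j hj)

/-- ★★ **PLAQUETTE EDITION** (`SU(N)`, the printed `exp[mean log]`, standing range `k ≤ m + K`): if for every `j < k` and every level-`(j+1)` bond
`c′` of the segment, every level-`j` plaquette of `M^j U₀` based in the three blocks `B(c′₋ − e_c) ∪ B(c′₋) ∪ B(c′₊)` is within `a j ≥ 0` of `1`, with
`t j := (((d+2)L)²∕4)·a j < δ_N`, then `dist1 ((M^k U₀)(c) · U₀([embIter k c₋ → L^k e_c])⁻¹) ≤ θ k` for any `θ` with `0 ≤ θ 0`,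
`6·t j + L·θ j ≤ θ (j+1)` (`BlockAveragingPlaquetteBoundLocal.dist1_corr_le_local`).  The plaquette smallness of the averaged fields near the segment
is the CALLER's letter ([Balaban1985Averaging] Prop. 1 in local form, `plaqSmallOn_avgFun_of_near`, iterated on its geometry).
[cite: Balaban1987RG1, (0.4) and (0.11) p.253; Balaban1985Averaging, (26)–(27) p.22] -/
theorem dist1_iter_mul_inv_straight_le_of_plaqSmall_local (U₀ : GaugeField P 0 (Matrix.specialUnitaryGroup n ℂ)) (a θ : ℕ → ℝ)
    (hθ0 : 0 ≤ θ 0)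
    (hθ : ∀ j, 6 * (((((P.d + 2) * P.L : ℕ) : ℝ) ^ 2 / 4) * a j) + P.L * θ j ≤ θ (j + 1)) (k : ℕ) (hk : k ≤ P.m + P.K)
    (c : PBond P k) (ha0 : ∀ j < k, 0 ≤ a j) (haN : ∀ j < k, ((((P.d + 2) * P.L : ℕ) : ℝ) ^ 2 / 4) * a j < deltaSU n)
    (ha : ∀ j < k, ∀ c' : PBond P (j + 1), c'.dir = c.dir →
        (∃ s < P.L ^ k, embIter (j + 1) c'.src = (fun z : Site P 0 => z.shift c.dir)^[s] (embIter k c.src)) →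
        ∀ q : Plaq P j, (blockOf q.src = c'.src.unshift c'.dir ∨ blockOf q.src = c'.src ∨ blockOf q.src = c'.tgt) →
          dist1 (GaugeField.plaqHol (Averaging.iter (fun i => blockAvg (P := P) (j := i) (expMeanLogSU (n := n))) j U₀) q) < a j) :
    dist1 (Averaging.iter (fun i => blockAvg (P := P) (j := i) (expMeanLogSU (n := n))) k U₀ c *
        (holAt U₀ (walk (embIter k c.src) (List.replicate (P.L ^ k) (c.dir, true))))⁻¹) ≤ θ k :=
  dist1_iter_blockAvg_mul_inv_straight_le_local (expMeanLogSU (n := n)) U₀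
    (fun j => 6 * (((((P.d + 2) * P.L : ℕ) : ℝ) ^ 2 / 4) * a j)) θ hθ0 hθ k c
    fun j hj c' hdir hs =>
      BlockAveragingPlaquetteBoundLocal.dist1_corr_le_local (ha0 j hj) (by omega) c' (ha j hj c' hdir hs) (haN j hj)

/-- ★ **PLAQUETTE EDITION, STRAIGHT-TRANSPORTER READING**: under the hypotheses of `dist1_iter_mul_inv_straight_le_of_plaqSmall_local`,
`dist1 (U₀([embIter k c₋ → L^k e_c])) ≤ θ k + dist1 ((M^k U₀)(c))`. [cite: Balaban1987RG1, (0.4) and (0.11) p.253] -/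
theorem dist1_straight_le_of_plaqSmall_local (U₀ : GaugeField P 0 (Matrix.specialUnitaryGroup n ℂ)) (a θ : ℕ → ℝ)
    (hθ0 : 0 ≤ θ 0)
    (hθ : ∀ j, 6 * (((((P.d + 2) * P.L : ℕ) : ℝ) ^ 2 / 4) * a j) + P.L * θ j ≤ θ (j + 1)) (k : ℕ) (hk : k ≤ P.m + P.K)
    (c : PBond P k) (ha0 : ∀ j < k, 0 ≤ a j) (haN : ∀ j < k, ((((P.d + 2) * P.L : ℕ) : ℝ) ^ 2 / 4) * a j < deltaSU n)
    (ha : ∀ j < k, ∀ c' : PBond P (j + 1), c'.dir = c.dir →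
        (∃ s < P.L ^ k, embIter (j + 1) c'.src = (fun z : Site P 0 => z.shift c.dir)^[s] (embIter k c.src)) →
        ∀ q : Plaq P j, (blockOf q.src = c'.src.unshift c'.dir ∨ blockOf q.src = c'.src ∨ blockOf q.src = c'.tgt) →
          dist1 (GaugeField.plaqHol (Averaging.iter (fun i => blockAvg (P := P) (j := i) (expMeanLogSU (n := n))) j U₀) q) < a j) :
    dist1 (holAt U₀ (walk (embIter k c.src) (List.replicate (P.L ^ k) (c.dir, true))))
      ≤ θ k + dist1 (Averaging.iter (fun i => blockAvg (P := P) (j := i) (expMeanLogSU (n := n))) k U₀ c) :=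
  (dist1_le_dist1_mul_inv_add _ _).trans
    (add_le_add (dist1_iter_mul_inv_straight_le_of_plaqSmall_local U₀ a θ hθ0 hθ k hk c ha0 haN ha) le_rfl)

end SUN

end Literature.MathematicalPhysics.QuantumFieldTheory.Balaban1983to89.BlockAveragingTowerStraightTransportLocal

end
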